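import Mathlib
import Literature.Probability.Percolation.PercolationProofs
import HarnessLib

/-!
# Crux `PercBurnResprinkle.JumpFireBreak` (stmt-CriticalPhenomena-7204), line `vacant-coins-fresh-spine` — stub `stub_markovTransfer`

Helper file for the crux skeleton `Cruxes/JumpFireBreak/Lines/vacant-coins-fresh-spine.lean` (lead
prover-line-stmt-CriticalPhenomena-7204-0).  Proves exactly the registered stub signature; lands with
`--supports stmt-CriticalPhenomena-7204`.

The finite-volume Markov identities pass to the limit `N → ∞` (box-burnt sets decrease to the burnt set) and give the two-field = one-field measure identity for the vacant percolation event.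

## Proof route (no π–λ argument)

Write `vac_N(U; W)` for the level-`q` configuration of the labels `W` off the box-burnt set
`B_N(U) = {v | v ↔ (box N)ᶜ in ω_p(U)}` and `vac_∞(U; W)` for the level-`q` configuration of `W` off
the burnt set `I_p(U) = {y | C_{ω_p(U)}(y) infinite}`.  Since `B_N(U) ↓ I_p(U)`, the configurations
`vac_N(U; W)` increase in `N` with union `vac_∞(U; W)`.

* For the LOCAL increasing events `A_{m,n} = {ω | ∃ x ∈ box m, ∃ y ∈ C_ω(x), y - x ∉ box n}` one has
  `{vac_∞ ∈ A_{m,n}} = ⋃_N {vac_N ∈ A_{m,n}}` (a witnessing open path is finite), an increasing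
  union, so continuity from below and the hypothesis (tested on `univ ×ˢ A_{m,n}`) identify the
  two-field and one-field probabilities of `{vac_∞ ∈ A_{m,n}}` (`measure_local_eq_iSup`).
* `n → ∞`: `⋂_n A_{m,n} = {∃ x ∈ box m, C(x) infinite}` (continuity from above, these events are
  measurable), then `m → ∞`: increasing union `{∃ x, C(x) infinite}` (`measure_existsInfinite_eq`).
* The one-field event on the product space is a cylinder `OwnPerc ×ˢ univ` (`Measure.prod_prod`).
-/

noncomputable section

namespace Summit.CriticalPhenomena.PercolationContinuityZ3.Theorems

open MeasureTheory ProbabilityTheory Literature.Probability.Percolation Literature.Probability.LatticeModels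

namespace MarkovTransfer

/-! ### Boxes exhaust `ℤ³` -/

/-- The boxes `box 3 n` increase with `n` (coercion form of the tree's `box_mono`). [folklore] -/
theorem coe_box_mono {n n' : ℕ} (h : n ≤ n') :
    (box 3 n : Set (Fin 3 → ℤ)) ⊆ (box 3 n' : Set (Fin 3 → ℤ)) :=
  Finset.coe_subset.2 (box_mono 3 h)

/-- A finite set of sites of `ℤ³` lies in some box. [folklore] -/
theorem exists_subset_box {s : Set (Fin 3 → ℤ)} (hs : s.Finite) :
    ∃ n : ℕ, s ⊆ (box 3 n : Set (Fin 3 → ℤ)) := by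
  obtain ⟨N, hN⟩ := (hs.image fun y : Fin 3 → ℤ => Finset.univ.sup fun i => (y i).natAbs).bddAbove
  refine ⟨N, fun w hw => ?_⟩
  have hle : (Finset.univ.sup fun i => (w i).natAbs) ≤ N := hN ⟨w, hw, rfl⟩
  rw [Finset.mem_coe, mem_box]
  intro i
  have h1 : (w i).natAbs ≤ N :=
    (Finset.le_sup (f := fun i => (w i).natAbs) (Finset.mem_univ i)).trans hle
  have h2 : (((w i).natAbs : ℕ) : ℤ) ≤ N := by exact_mod_cast h1
  rw [Int.natCast_natAbs] at h2
  exact abs_le.1 h2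

/-- Every site of `ℤ³` lies in some box (the tree's `iUnion_coe_box`). [folklore] -/
theorem exists_mem_box (x : Fin 3 → ℤ) : ∃ n : ℕ, x ∈ (box 3 n : Set (Fin 3 → ℤ)) := by
  have h := Set.mem_univ x
  rw [← iUnion_coe_box 3] at h
  exact Set.mem_iUnion.1 h

/-- A translate `x + box n` of a box is finite. [folklore] -/
theorem finite_sub_mem_box (x : Fin 3 → ℤ) (n : ℕ) :
    {y : Fin 3 → ℤ | y - x ∈ (box 3 n : Set (Fin 3 → ℤ))}.Finite :=
  (box 3 n).finite_toSet.preimage sub_left_injective.injOn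

/-! ### The local events `A_{m,n}` -/

/-- `⋂_n A_{m,n} = {∃ x ∈ box m, C(x) infinite}`: some `x ∈ box m` has an infinite open cluster iff
for every `n` some `x ∈ box m` is joined to a vertex outside `x + box n` (`⇐`: finitely many finite
clusters are bounded). [folklore] -/
theorem exists_infinite_iff_forall (η : Set (Sym2 (Fin 3 → ℤ))) (m : ℕ) :
    (∃ x ∈ (box 3 m : Set (Fin 3 → ℤ)), (openCluster η x).Infinite) ↔
      ∀ n : ℕ, ∃ x ∈ (box 3 m : Set (Fin 3 → ℤ)), ∃ y ∈ openCluster η x,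
        y - x ∉ (box 3 n : Set (Fin 3 → ℤ)) := by
  constructor
  · rintro ⟨x, hx, hinf⟩ n
    obtain ⟨y, hy, hyn⟩ := hinf.exists_notMem_finite (finite_sub_mem_box x n)
    exact ⟨x, hx, y, hy, hyn⟩
  · intro h
    by_contra hfin
    have hfin' : ∀ x ∈ (box 3 m : Set (Fin 3 → ℤ)), (openCluster η x).Finite :=
      fun x hx => Set.not_infinite.1 fun hinf => hfin ⟨x, hx, hinf⟩
    have hD : (⋃ x ∈ (box 3 m : Set (Fin 3 → ℤ)), (fun y => y - x) '' openCluster η x).Finite :=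
      (box 3 m).finite_toSet.biUnion fun x hx => (hfin' x hx).image _
    obtain ⟨n, hn⟩ := exists_subset_box hD
    obtain ⟨x, hx, y, hy, hyx⟩ := h n
    exact hyx (hn (Set.mem_biUnion hx ⟨y, hy, rfl⟩))

/-- A finite open path of `F` is already open in some approximant `Fs N` when the `Fs N` increase
and exhaust `F`. [folklore] -/
theorem exists_reachable_of_exhaust {F : Set (Sym2 (Fin 3 → ℤ))} {Fs : ℕ → Set (Sym2 (Fin 3 → ℤ))}
    (hmono : Monotone Fs) (hexh : ∀ e ∈ F, ∃ N, e ∈ Fs N) {x y : Fin 3 → ℤ}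
    (h : (openGraph F).Reachable x y) : ∃ N, (openGraph (Fs N)).Reachable x y := by
  obtain ⟨w⟩ := h
  induction w with
  | nil => exact ⟨0, SimpleGraph.Reachable.refl _⟩
  | cons hadj _ ih =>
    obtain ⟨N₁, h₁⟩ := ih
    rw [openGraph_adj] at hadj
    obtain ⟨N₂, h₂⟩ := hexh _ hadj.1
    refine ⟨max N₁ N₂, ?_⟩
    have hadj' : (openGraph (Fs (max N₁ N₂))).Adj _ _ :=
      (openGraph_adj _ _ _).2 ⟨hmono (le_max_right _ _) h₂, hadj.2⟩
    exact hadj'.reachable.trans (h₁.mono (SimpleGraph.fromEdgeSet_mono (hmono (le_max_left _ _))))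

/-- The local event `A_{m,n} = {ω | ∃ x ∈ box m, ∃ y ∈ C_ω(x), y - x ∉ box n}` is measurable
(a countable union of connection events). [folklore] -/
theorem measurableSet_local (m n : ℕ) :
    MeasurableSet {η : Set (Sym2 (Fin 3 → ℤ)) | ∃ x ∈ (box 3 m : Set (Fin 3 → ℤ)),
      ∃ y ∈ openCluster η x, y - x ∉ (box 3 n : Set (Fin 3 → ℤ))} := by
  refine measurableSet_setOf.2 (Measurable.exists fun x => measurable_const.and
    (Measurable.exists fun y => Measurable.and ?_ measurable_const))
  have h : MeasurableSet {ω : Set (Sym2 (Fin 3 → ℤ)) | (openGraph ω).Reachable x y} :=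
    measurableSet_openConn_holds x y
  exact measurableSet_setOf.1 h

/-! ### Continuity of measure along the local events -/

/-- **`m, n` limits.** For a measurable random configuration `F` under a finite measure,
`P{∃ x, C_F(x) infinite} = sup_m inf_n P{F ∈ A_{m,n}}` (continuity from below in `m`, from above in
`n`). [folklore] -/
theorem measure_existsInfinite_eq {Ω : Type*} [MeasurableSpace Ω] (P : Measure Ω)
    [IsFiniteMeasure P] {F : Ω → Set (Sym2 (Fin 3 → ℤ))} (hF : Measurable F) :
    P {ω | ∃ x, (openCluster (F ω) x).Infinite} =
      ⨆ m : ℕ, ⨅ n : ℕ, P {ω | ∃ x ∈ (box 3 m : Set (Fin 3 → ℤ)), ∃ y ∈ openCluster (F ω) x,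
        y - x ∉ (box 3 n : Set (Fin 3 → ℤ))} := by
  have h1 : {ω | ∃ x, (openCluster (F ω) x).Infinite} =
      ⋃ m : ℕ, {ω | ∃ x ∈ (box 3 m : Set (Fin 3 → ℤ)), (openCluster (F ω) x).Infinite} := by
    ext ω
    simp only [Set.mem_setOf_eq, Set.mem_iUnion]
    constructor
    · rintro ⟨x, hx⟩
      obtain ⟨m, hm⟩ := exists_mem_box x
      exact ⟨m, x, hm, hx⟩
    · rintro ⟨m, x, -, hx⟩
      exact ⟨x, hx⟩
  have hmono : Monotone fun m : ℕ =>
      {ω | ∃ x ∈ (box 3 m : Set (Fin 3 → ℤ)), (openCluster (F ω) x).Infinite} := by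
    intro m m' h ω hω
    obtain ⟨x, hx, hinf⟩ := hω
    exact ⟨x, coe_box_mono h hx, hinf⟩
  rw [h1, hmono.measure_iUnion]
  refine iSup_congr fun m => ?_
  have h2 : {ω | ∃ x ∈ (box 3 m : Set (Fin 3 → ℤ)), (openCluster (F ω) x).Infinite} =
      ⋂ n : ℕ, {ω | ∃ x ∈ (box 3 m : Set (Fin 3 → ℤ)), ∃ y ∈ openCluster (F ω) x,
        y - x ∉ (box 3 n : Set (Fin 3 → ℤ))} := by
    ext ω
    simp only [Set.mem_setOf_eq, Set.mem_iInter]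
    exact exists_infinite_iff_forall (F ω) m
  rw [h2]
  refine Antitone.measure_iInter ?_ (fun n => (hF (measurableSet_local m n)).nullMeasurableSet)
    ⟨0, measure_ne_top P _⟩
  intro n n' h ω ⟨x, hx, y, hy, hyx⟩
  exact ⟨x, hx, y, hy, fun h' => hyx (coe_box_mono h h')⟩

/-- **`N` limit.** If the configurations `Fs N` increase in `N` and exhaust `F`, then
`P{F ∈ A_{m,n}} = sup_N P{Fs N ∈ A_{m,n}}` (a witnessing open path is finite; continuity from below,
no measurability needed). [folklore] -/
theorem measure_local_eq_iSup {Ω : Type*} [MeasurableSpace Ω] (P : Measure Ω)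
    (F : Ω → Set (Sym2 (Fin 3 → ℤ))) (Fs : ℕ → Ω → Set (Sym2 (Fin 3 → ℤ)))
    (hmono : ∀ ω, Monotone fun N => Fs N ω) (hsub : ∀ N ω, Fs N ω ⊆ F ω)
    (hexh : ∀ ω, ∀ e ∈ F ω, ∃ N, e ∈ Fs N ω) (m n : ℕ) :
    P {ω | ∃ x ∈ (box 3 m : Set (Fin 3 → ℤ)), ∃ y ∈ openCluster (F ω) x,
        y - x ∉ (box 3 n : Set (Fin 3 → ℤ))} =
      ⨆ N : ℕ, P {ω | ∃ x ∈ (box 3 m : Set (Fin 3 → ℤ)), ∃ y ∈ openCluster (Fs N ω) x,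
        y - x ∉ (box 3 n : Set (Fin 3 → ℤ))} := by
  have hset : {ω | ∃ x ∈ (box 3 m : Set (Fin 3 → ℤ)), ∃ y ∈ openCluster (F ω) x,
      y - x ∉ (box 3 n : Set (Fin 3 → ℤ))} =
      ⋃ N : ℕ, {ω | ∃ x ∈ (box 3 m : Set (Fin 3 → ℤ)), ∃ y ∈ openCluster (Fs N ω) x,
        y - x ∉ (box 3 n : Set (Fin 3 → ℤ))} := by
    ext ω
    simp only [Set.mem_setOf_eq, Set.mem_iUnion]
    constructor
    · rintro ⟨x, hx, y, hy, hyx⟩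
      obtain ⟨N, hN⟩ := exists_reachable_of_exhaust (hmono ω) (hexh ω) hy
      exact ⟨N, x, hx, y, hN, hyx⟩
    · rintro ⟨N, x, hx, y, hy, hyx⟩
      exact ⟨x, hx, y, openCluster_mono (hsub N ω) x hy, hyx⟩
  rw [hset]
  exact Monotone.measure_iUnion fun N N' h ω ⟨x, hx, y, hy, hyx⟩ =>
    ⟨x, hx, y, openCluster_mono (hmono ω h) x hy, hyx⟩

/-- The measure of a cylinder over the first factor under a product with a probability measure.
[folklore] -/
theorem measure_prod_setOf_fst {α β : Type*} [MeasurableSpace α] [MeasurableSpace β]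
    (μ : Measure α) (ν : Measure β) [SFinite ν] [IsProbabilityMeasure ν] (Q : α → Prop) :
    μ.prod ν {π | Q π.1} = μ {a | Q a} := by
  have : {π : α × β | Q π.1} = {a | Q a} ×ˢ Set.univ := by
    ext π
    simp
  rw [this, Measure.prod_prod, measure_univ, mul_one]

/-! ### The vacant configurations `vac_N(U; W) ↑ vac_∞(U; W)` -/

/-- `vac_N(U; W)` increases with `N` (the box-burnt sets decrease). [folklore] -/
theorem vacN_mono (p q : ℝ) (U W : Sym2 (Fin 3 → ℤ) → ℝ) :
    Monotone fun N : ℕ => {e : Sym2 (Fin 3 → ℤ) | e ∈ configOfLabels q W (zdGraph 3) ∧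
      ∀ y ∈ e, ¬ ∃ w : Fin 3 → ℤ, w ∉ (box 3 N : Set (Fin 3 → ℤ)) ∧
        (openGraph (configOfLabels p U (zdGraph 3))).Reachable y w} := by
  intro N N' h e he
  exact ⟨he.1, fun y hye ⟨w, hw, hr⟩ => he.2 y hye ⟨w, fun hw' => hw (coe_box_mono h hw'), hr⟩⟩

/-- `vac_N(U; W) ⊆ vac_∞(U; W)`: an infinite cluster leaves every box. [folklore] -/
theorem vacN_subset (p q : ℝ) (U W : Sym2 (Fin 3 → ℤ) → ℝ) (N : ℕ) :
    {e : Sym2 (Fin 3 → ℤ) | e ∈ configOfLabels q W (zdGraph 3) ∧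
      ∀ y ∈ e, ¬ ∃ w : Fin 3 → ℤ, w ∉ (box 3 N : Set (Fin 3 → ℤ)) ∧
        (openGraph (configOfLabels p U (zdGraph 3))).Reachable y w} ⊆
    {e | e ∈ configOfLabels q W (zdGraph 3) ∧
      ∀ y ∈ e, ¬ (openCluster (configOfLabels p U (zdGraph 3)) y).Infinite} := by
  rintro e ⟨he, hy⟩
  refine ⟨he, fun y hye hinf => hy y hye ?_⟩
  obtain ⟨w, hw, hwN⟩ := hinf.exists_notMem_finset (box 3 N)
  exact ⟨w, fun h => hwN (Finset.mem_coe.1 h), hw⟩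

/-- `⋃_N vac_N(U; W) = vac_∞(U; W)`: a vacant edge of `vac_∞` has two finite, hence boxed,
environment clusters at its endpoints. [folklore] -/
theorem exists_mem_vacN (p q : ℝ) (U W : Sym2 (Fin 3 → ℤ) → ℝ) (e : Sym2 (Fin 3 → ℤ))
    (he : e ∈ {e : Sym2 (Fin 3 → ℤ) | e ∈ configOfLabels q W (zdGraph 3) ∧
      ∀ y ∈ e, ¬ (openCluster (configOfLabels p U (zdGraph 3)) y).Infinite}) :
    ∃ N : ℕ, e ∈ {e : Sym2 (Fin 3 → ℤ) | e ∈ configOfLabels q W (zdGraph 3) ∧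
      ∀ y ∈ e, ¬ ∃ w : Fin 3 → ℤ, w ∉ (box 3 N : Set (Fin 3 → ℤ)) ∧
        (openGraph (configOfLabels p U (zdGraph 3))).Reachable y w} := by
  revert he
  refine Sym2.inductionOn e fun a b => ?_
  rintro ⟨he, hy⟩
  rw [Sym2.forall_mem_pair] at hy
  obtain ⟨Na, hNa⟩ := exists_subset_box (Set.not_infinite.1 hy.1)
  obtain ⟨Nb, hNb⟩ := exists_subset_box (Set.not_infinite.1 hy.2)
  refine ⟨max Na Nb, he, ?_⟩
  rw [Sym2.forall_mem_pair]
  exact ⟨fun ⟨w, hw, hr⟩ => hw (coe_box_mono (le_max_left _ _) (hNa hr)),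
    fun ⟨w, hw, hr⟩ => hw (coe_box_mono (le_max_right _ _) (hNb hr))⟩

/-- `(U, W) ↦ vac_∞(U; W)` is measurable: coordinate `s(a, b)` is the event
`{U'_{s(a,b)} ≤ q} ∩ {a ∉ I_p(U)} ∩ {b ∉ I_p(U)}` (`measurableSet_percolatesAt_holds`).
[folklore] -/
theorem measurable_vac (p q : ℝ) :
    Measurable fun π : (Sym2 (Fin 3 → ℤ) → ℝ) × (Sym2 (Fin 3 → ℤ) → ℝ) =>
      {e : Sym2 (Fin 3 → ℤ) | e ∈ configOfLabels q π.2 (zdGraph 3) ∧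
        ∀ y ∈ e, ¬ (openCluster (configOfLabels p π.1 (zdGraph 3)) y).Infinite} := by
  refine measurable_set_iff.2 (Sym2.ind fun a b => ?_)
  simp only [Set.mem_setOf_eq, Sym2.forall_mem_pair]
  have hI : ∀ c : Fin 3 → ℤ, Measurable fun π : (Sym2 (Fin 3 → ℤ) → ℝ) × (Sym2 (Fin 3 → ℤ) → ℝ) =>
      (openCluster (configOfLabels p π.1 (zdGraph 3)) c).Infinite := by
    intro c
    have h : MeasurableSet {π : (Sym2 (Fin 3 → ℤ) → ℝ) × (Sym2 (Fin 3 → ℤ) → ℝ) |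
        configOfLabels p π.1 (zdGraph 3) ∈ percolatesAt c} :=
      ((measurable_configOfLabels p (zdGraph 3)).comp measurable_fst)
        (measurableSet_percolatesAt_holds c)
    exact measurableSet_setOf.1 h
  have hq : Measurable fun π : (Sym2 (Fin 3 → ℤ) → ℝ) × (Sym2 (Fin 3 → ℤ) → ℝ) =>
      s(a, b) ∈ configOfLabels q π.2 (zdGraph 3) :=
    (measurable_set_mem _).comp ((measurable_configOfLabels q (zdGraph 3)).comp measurable_snd)
  exact hq.and ((hI a).not.and (hI b).not)

end MarkovTransfer

/-- Registered stub `stub_markovTransfer` of crux stmt-CriticalPhenomena-7204 (line vacant-coins-fresh-spine); see the line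
skeleton `Cruxes/JumpFireBreak/Lines/vacant-coins-fresh-spine.lean` for the informal statement and sources. -/
theorem stub_markovTransfer :
    ∀ (p q : ℝ),
    (∀ (N : ℕ) (S : Set (Set (Fin 3 → ℤ) × Set (Sym2 (Fin 3 → ℤ)))), MeasurableSet S →
      ((labelMeasure (Fin 3 → ℤ)).prod (labelMeasure (Fin 3 → ℤ)))
          {π | ({v | ∃ w : Fin 3 → ℤ, w ∉ (box 3 N : Set (Fin 3 → ℤ)) ∧
                  (openGraph (configOfLabels p π.1 (zdGraph 3))).Reachable v w},
                {e | e ∈ configOfLabels q π.1 (zdGraph 3) ∧ ∀ y ∈ e, ¬ ∃ w : Fin 3 → ℤ,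
                  w ∉ (box 3 N : Set (Fin 3 → ℤ)) ∧ (openGraph (configOfLabels p π.1 (zdGraph 3))).Reachable y w})
                ∈ S} =
        ((labelMeasure (Fin 3 → ℤ)).prod (labelMeasure (Fin 3 → ℤ)))
          {π | ({v | ∃ w : Fin 3 → ℤ, w ∉ (box 3 N : Set (Fin 3 → ℤ)) ∧
                  (openGraph (configOfLabels p π.1 (zdGraph 3))).Reachable v w},
                {e | e ∈ configOfLabels q π.2 (zdGraph 3) ∧ ∀ y ∈ e, ¬ ∃ w : Fin 3 → ℤ,
                  w ∉ (box 3 N : Set (Fin 3 → ℤ)) ∧ (openGraph (configOfLabels p π.1 (zdGraph 3))).Reachable y w})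
                ∈ S}) →
    ((labelMeasure (Fin 3 → ℤ)).prod (labelMeasure (Fin 3 → ℤ)))
        {π | ∃ x : Fin 3 → ℤ, (openCluster {e | e ∈ configOfLabels q π.2 (zdGraph 3) ∧
          ∀ y ∈ e, ¬ (openCluster (configOfLabels p π.1 (zdGraph 3)) y).Infinite} x).Infinite} =
      (labelMeasure (Fin 3 → ℤ))
        {U | ∃ x : Fin 3 → ℤ, (openCluster {e | e ∈ configOfLabels q U (zdGraph 3) ∧
          ∀ y ∈ e, ¬ (openCluster (configOfLabels p U (zdGraph 3)) y).Infinite} x).Infinite} := by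
  intro p q hMarkov
  haveI := isProbabilityMeasure_labelMeasure (Fin 3 → ℤ)
  have hmeas₂ := MarkovTransfer.measurable_vac p q
  have hmeas₁ : Measurable fun U : Sym2 (Fin 3 → ℤ) → ℝ =>
      {e : Sym2 (Fin 3 → ℤ) | e ∈ configOfLabels q U (zdGraph 3) ∧
        ∀ y ∈ e, ¬ (openCluster (configOfLabels p U (zdGraph 3)) y).Infinite} :=
    hmeas₂.comp (measurable_id.prodMk measurable_id)
  rw [MarkovTransfer.measure_existsInfinite_eq _ hmeas₂,
    MarkovTransfer.measure_existsInfinite_eq _ hmeas₁]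
  refine iSup_congr fun m => iInf_congr fun n => ?_
  refine (MarkovTransfer.measure_local_eq_iSup _ _
    (fun N π => {e : Sym2 (Fin 3 → ℤ) | e ∈ configOfLabels q π.2 (zdGraph 3) ∧
      ∀ y ∈ e, ¬ ∃ w : Fin 3 → ℤ, w ∉ (box 3 N : Set (Fin 3 → ℤ)) ∧
        (openGraph (configOfLabels p π.1 (zdGraph 3))).Reachable y w})
    (fun π => MarkovTransfer.vacN_mono p q π.1 π.2)
    (fun N π => MarkovTransfer.vacN_subset p q π.1 π.2 N)
    (fun π => MarkovTransfer.exists_mem_vacN p q π.1 π.2) m n).trans ?_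
  refine Eq.trans ?_ (MarkovTransfer.measure_local_eq_iSup _ _
    (fun N U => {e : Sym2 (Fin 3 → ℤ) | e ∈ configOfLabels q U (zdGraph 3) ∧
      ∀ y ∈ e, ¬ ∃ w : Fin 3 → ℤ, w ∉ (box 3 N : Set (Fin 3 → ℤ)) ∧
        (openGraph (configOfLabels p U (zdGraph 3))).Reachable y w})
    (fun U => MarkovTransfer.vacN_mono p q U U)
    (fun N U => MarkovTransfer.vacN_subset p q U U N)
    (fun U => MarkovTransfer.exists_mem_vacN p q U U) m n).symm
  refine iSup_congr fun N => ?_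
  have key := hMarkov N
    (Set.univ ×ˢ {η : Set (Sym2 (Fin 3 → ℤ)) | ∃ x ∈ (box 3 m : Set (Fin 3 → ℤ)),
      ∃ y ∈ openCluster η x, y - x ∉ (box 3 n : Set (Fin 3 → ℤ))})
    (MeasurableSet.univ.prod (MarkovTransfer.measurableSet_local m n))
  simp only [Set.mem_prod, Set.mem_univ, true_and, Set.mem_setOf_eq] at key
  refine key.symm.trans ?_
  exact MarkovTransfer.measure_prod_setOf_fst (labelMeasure (Fin 3 → ℤ)) (labelMeasure (Fin 3 → ℤ))
    (fun U => ∃ x ∈ (box 3 m : Set (Fin 3 → ℤ)), ∃ y ∈ openCluster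
      {e : Sym2 (Fin 3 → ℤ) | e ∈ configOfLabels q U (zdGraph 3) ∧
        ∀ y ∈ e, ¬ ∃ w : Fin 3 → ℤ, w ∉ (box 3 N : Set (Fin 3 → ℤ)) ∧
          (openGraph (configOfLabels p U (zdGraph 3))).Reachable y w} x,
      y - x ∉ (box 3 n : Set (Fin 3 → ℤ)))

end Summit.CriticalPhenomena.PercolationContinuityZ3.Theorems

end
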